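import Literature.NumberTheory.EllipticCurves.ShaIsogenyProofs
import Literature.NumberTheory.EllipticCurves.IsogenyRationalCMProofs
import Summits.BirchSwinnertonDyer.BirchSwinnertonDyer.Theorems.SylvesterTwoHeegnerIndexUnramifiedQuadraticDescent
import HarnessLib

/-!
# Route `SylvesterTwoHeegnerIndex` (rung K7t), crux `UpperOffV0HSYPlus` (item 19804): the ARITHMETIC
# WRAPPER, brick (WRAP-𝒪) — the `ℤ[ζ₃]`-module structure on the TREE's Tate–Shafarevich group of
# `y² = x³ + B` over a number field containing a primitive cube root of unity

Cell `bsd-cm` (`run/shared/lean/pub/bsd-cm/`), seat `bsd-cm-k7t-c2` (prover-bsd-cm-k7t-c2-g19-0; hand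
item 19229 `HeegnerIndexUpperAtTwoHSY`, verdict unchanged: NOT FOUND as a theorem), planner GO
STATUS l.1783 under D347 (M1)(K-ty) «VARIANT K infrastructure line»; kernel helper
`--supports stmt-BirchSwinnertonDyer-19804 --as helper`. PARTITION (D-0054): CornerF at `p = 2`
(B14/O12) × 𝒞_HSY (`E_p : x³ + y³ = p`) × `p = 2` — types-the-object-of: the `ℤ[ω]`-module structure
`w = [ω]_*` on `Ш(E_p/ℚ(ω))[2^∞]`, i.e. the «`w`» half of the data `(M, w, σ)` of LEMMA D ≡ LEMMA K0
(`SylvesterTwoUnramifiedDescent`, Part I of the ROAD (k) series p553247–p581644), now on the TREE's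
own `Ш = ker (H¹(K, E) → ∏_v H¹(K_v, E))` (`Literature/…/Sha.lean`: Mathlib continuous cohomology of
`Γ_K` on `E(K̄)`). Closes no cell and no item; BSD is not claimed; nothing about the ORDER of `Ш` is
asserted. Everything is PROVED: no definition, no instance, no notation, no named fact, no `sorry`.

## What is proved

§1 (any `W, W'` over a field `K`): `galH1Map_add` — additivity of the tree's
`galH1Map` (= Mathlib `ContinuousCohomology.map`) in the coefficient map, companion of its
functoriality `galH1Map_galH1Map`; `galH1Map_galH1Map_add_galH1Map_add_self_eq_zero` and
`shaMap_shaMap_add_shaMap_add_self_eq_zero` — a relation `f ∘ f + f + 1 = 0` on `E(K̄)` passes to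
`H¹(K, E)` and to the tree's `Ш(E/K)` (`Literature.NumberTheory.EllipticCurves.shaMap`).
§2 (group law, any `W` with `a₁ = a₂ = a₃ = a₄ = 0`): `some_add_some_of_Y_eq` (two points on a
horizontal line add to minus the third), `some_zero_add_self` (`(0, y)` is a flex),
`some_add_some_add_some_eq_zero` (TRACE IDENTITY `(ζx, y) + (ζ²x, y) + (x, y) = O`, `ζ³ = 1 ≠ ζ`).
§3 `apply_apply_add_apply_add_self_eq_zero` — for `W = ⟨0, 0, 0, 0, B⟩` over `K` of characteristic
`0` with a primitive cube root `ζ ∈ K`, any endomorphism of `E(K̄)` acting by `(x, y) ↦ (ζ²x, ζ³y)`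
(e.g. the endo-isogeny `[ζ]` of
`IsogenyRationalCMProofs.exists_isogeny_apply_eq_of_pow_four_mul_eq_of_pow_six_mul_eq`) satisfies
`[ζ]² + [ζ] + 1 = 0`.
§4 (WRAP-𝒪) `exists_cm_shaMap_relation` — `K` a number field: `w := Ш([ζ])` (through
`Isogeny.hasLocalPointsMaps_toAddMonoidHom`) satisfies `w² + w + 1 = 0` on `Ш(W/K)`;
`exists_cm_action_sha_two_primary` — its restriction to `Ш(W/K)[2^∞]` plus
`SylvesterTwoUnramifiedDescent.three_zsmul_bijective_of_two_primary` = EXACTLY the hypotheses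
`(w, hw, h3)` of `SylvesterTwoUnramifiedDescent.descent_bijective` / `card_eq_card_invariants_sq`
for the genuine `Ш`.

## What is NOT here (the open (K-ty) content of D347)
(WRAP-σ): complex conjugation `σ` on `H¹(ℚ(ω), E)` (functoriality along the outer automorphism of
`Γ_{ℚ(ω)}` with a semilinear coefficient map) and `σ w = w̄ σ`; the transport from `⟨0, 0, 0, 0, B⟩`
to an arbitrary minimal model of `E_p` (`VariableChange.toIsogeny`); the Kolyvagin-class vocabulary
in Hu–Shu–Yin's CM frame. Item words of 19229/19804 are unchanged.

## References
Serre, *Galois Cohomology*, I.§2.4 (folklore); Milne, *Arithmetic Duality Theorems* (2006), I.§6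
p. 75, Lemma I.7.1 [MilneADT2006]; Silverman, *AEC* 2nd ed. (2009), III.2.3, Thm. III.10.1,
Cor. III.10.2 [SilvermanAEC2009]; cell: memo two v2.21 §57.1 (LEMMA K0), HANDOFF § k7t-c2 g16
«(WRAP-𝒪)», planner D347 (M1)(K-ty).
-/

set_option autoImplicit false
set_option linter.dupNamespace false

noncomputable section

open scoped Classical

universe u
open WeierstrassCurve Literature.NumberTheory.EllipticCurves
  Literature.NumberTheory.GaloisRepresentations

namespace Summit.BirchSwinnertonDyer.BirchSwinnertonDyer.Theorems.SylvesterTwoShaOmegaAction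

/-! ## §1 Additivity of `H¹(f)` in the coefficient map, and endomorphism relations on `H¹` and `Ш` -/

section GalH1

variable {K : Type u} [Field K] {W W' : WeierstrassCurve K}

/-- **`H¹(f + g) = H¹(f) + H¹(g)`** for `Γ_K`-equivariant homomorphisms `f, g : E(K̄) → E'(K̄)` of
geometric points: computed on continuous crossed homomorphisms, `[(f + g) ∘ a] = [f ∘ a] + [g ∘ a]`.
Serre, *Galois Cohomology*, I.§2.4 (functoriality of `H¹` in the coefficients). [folklore] -/
theorem galH1Map_add (f g : W.geomPoints →+ W'.geomPoints)
    (hf : ∀ (σ : Field.absoluteGaloisGroup K) (P : W.geomPoints), f (σ • P) = σ • f P)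
    (hg : ∀ (σ : Field.absoluteGaloisGroup K) (P : W.geomPoints), g (σ • P) = σ • g P)
    (c : W.galH1) :
    galH1Map (f + g) (fun σ P ↦ by simp [hf, hg]) c = galH1Map f hf c + galH1Map g hg c := by
  obtain ⟨a, rfl⟩ := oneCocycleClass_surjective _ c
  rw [galH1Map_oneCocycleClass, galH1Map_oneCocycleClass, galH1Map_oneCocycleClass,
    ← oneCocycleClass_add]
  congr 1

/-- **An endomorphism relation `φ ∘ φ + φ + 1 = 0` on `E(K̄)` passes to `H¹(K, E)`**: if the
`Γ_K`-equivariant endomorphism `f` of the geometric points satisfies `f (f P) + f P + P = 0` for all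
`P`, then `H¹(f) (H¹(f) c) + H¹(f) c + c = 0` for every class `c ∈ H¹(K, E)` (functoriality and
additivity of `H¹` in the coefficients). Serre, *Galois Cohomology*, I.§2.4. [folklore] -/
theorem galH1Map_galH1Map_add_galH1Map_add_self_eq_zero (f : W.geomPoints →+ W.geomPoints)
    (hf : ∀ (σ : Field.absoluteGaloisGroup K) (P : W.geomPoints), f (σ • P) = σ • f P)
    (h : ∀ P : W.geomPoints, f (f P) + f P + P = 0) (c : W.galH1) :
    galH1Map f hf (galH1Map f hf c) + galH1Map f hf c + c = 0 := by
  obtain ⟨a, rfl⟩ := oneCocycleClass_surjective _ c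
  rw [galH1Map_oneCocycleClass, galH1Map_oneCocycleClass, ← oneCocycleClass_add,
    ← oneCocycleClass_add]
  have h0 : contOneCocycles.push f hf (contOneCocycles.push f hf a) + contOneCocycles.push f hf a
      + a = 0 := by
    apply Subtype.ext
    ext σ
    exact h (a.1 σ)
  rw [h0]
  exact map_zero (oneCocycleClassₗ _)

variable [NumberField K]

/-- **The same relation on `Ш(E/K)`**: for an equivariant endomorphism `f` of `E(K̄)` with local
points maps and `f² + f + 1 = 0` pointwise, the induced `w := Ш(f) : Ш(E/K) → Ш(E/K)`
(`Literature.NumberTheory.EllipticCurves.shaMap`) satisfies `w (w c) + w c + c = 0` — i.e. `Ш(E/K)`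
is a `ℤ[ω]`-module through `w`. Milne, *ADT*, I.§6–7 (`Ш(f)`). [folklore] -/
theorem shaMap_shaMap_add_shaMap_add_self_eq_zero (f : W.geomPoints →+ W.geomPoints)
    (hf : ∀ (σ : Field.absoluteGaloisGroup K) (P : W.geomPoints), f (σ • P) = σ • f P)
    (hloc : HasLocalPointsMaps W W f) (h : ∀ P : W.geomPoints, f (f P) + f P + P = 0)
    (c : W.sha) :
    shaMap f hf hloc (shaMap f hf hloc c) + shaMap f hf hloc c + c = 0 := by
  apply Subtype.ext
  simp only [AddSubgroup.coe_add, coe_shaMap_apply, AddSubgroup.coe_zero]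
  exact galH1Map_galH1Map_add_galH1Map_add_self_eq_zero f hf h c

end GalH1

/-! ## §2 The group law on a horizontal line of `y² = x³ + a₆` -/

section HorizontalLine

variable {F : Type u} [Field F] {W : Affine F}

/-- On `y² = x³ + a₆` (all of `a₁, a₂, a₃, a₄` zero) two affine points with the SAME ordinate `y`
and distinct abscissae `x₁ ≠ x₂` add up to `-(x₃, y)` whenever `x₁ + x₂ + x₃ = 0` and `(x₃, y)` is
on the curve: the chord is the horizontal line `Y = y`, of slope `0`, whose third intersection has
abscissa `-a₂ - x₁ - x₂ = x₃`. Silverman, *AEC*, III.2.3 (group law algorithm). [folklore] -/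
theorem some_add_some_of_Y_eq (ha₁ : W.a₁ = 0) (ha₂ : W.a₂ = 0) (ha₃ : W.a₃ = 0)
    {x₁ x₂ x₃ y : F} (h₁ : W.Nonsingular x₁ y) (h₂ : W.Nonsingular x₂ y) (h₃ : W.Nonsingular x₃ y)
    (hx : x₁ ≠ x₂) (hsum : x₁ + x₂ + x₃ = 0) :
    Affine.Point.some x₁ y h₁ + Affine.Point.some x₂ y h₂ = -Affine.Point.some x₃ y h₃ := by
  have hL : W.slope x₁ x₂ y y = 0 := by
    rw [Affine.slope_of_X_ne hx, sub_self, zero_div]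
  rw [Affine.Point.add_of_X_ne hx, Affine.Point.neg_some]
  congr 1
  · rw [hL]
    simp only [Affine.addX, ha₁, ha₂]
    linear_combination -hsum
  · rw [hL]
    simp [Affine.addY, Affine.negAddY, Affine.negY, Affine.addX, ha₁, ha₃]

/-- On `y² = x³ + a₆` (all of `a₁, a₂, a₃, a₄` zero) with `2y ≠ 0`, the affine point `(0, y)`
doubles to its own negative: the tangent at `(0, y)` is horizontal (`3x² = 0`), so
`2·(0, y) = (0, -y) = -(0, y)` — `(0, y)` is a flex, of order `3`. Silverman, *AEC*, III.2.3.
[folklore] -/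
theorem some_zero_add_self (ha₁ : W.a₁ = 0) (ha₂ : W.a₂ = 0) (ha₃ : W.a₃ = 0) (ha₄ : W.a₄ = 0)
    {y : F} (hy0 : (2 : F) * y ≠ 0) (h : W.Nonsingular 0 y) :
    Affine.Point.some 0 y h + Affine.Point.some 0 y h = -Affine.Point.some 0 y h := by
  have hy : y ≠ W.negY 0 y := by
    intro e
    apply hy0
    have e' : y = -y - W.a₁ * 0 - W.a₃ := e
    rw [ha₃] at e'
    linear_combination e'
  have hL : W.slope 0 0 y y = 0 := by
    rw [Affine.slope_of_Y_ne rfl hy]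
    simp [Affine.negY, ha₁, ha₂, ha₄]
  rw [Affine.Point.add_self_of_Y_ne hy, Affine.Point.neg_some]
  congr 1
  · rw [hL]
    simp [Affine.addX, ha₁, ha₂]
  · rw [hL]
    simp [Affine.addY, Affine.negAddY, Affine.negY, Affine.addX, ha₁, ha₂, ha₃]

/-- **The trace identity on a horizontal line.** On `y² = x³ + a₆` (all of `a₁, a₂, a₃, a₄` zero)
over a field with `2 ≠ 0`, for `ζ ≠ 1` with `ζ³ = 1` (a primitive cube root of unity, so
`ζ² + ζ + 1 = 0`) and any affine point `(x, y)`, the three points `(ζx, y)`, `(ζ²x, y)`, `(x, y)`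
sum to `O`: for `x ≠ 0` they are the three (distinct) intersections with the line `Y = y`
(`X³ = y² - a₆` has the roots `x, ζx, ζ²x`); for `x = 0` they coincide with the flex `(0, y)` of
order `3`. Silverman, *AEC*, III.2.3 and III.10.1. [folklore] -/
theorem some_add_some_add_some_eq_zero (ha₁ : W.a₁ = 0) (ha₂ : W.a₂ = 0) (ha₃ : W.a₃ = 0)
    (ha₄ : W.a₄ = 0) {ζ : F} (h2 : (2 : F) ≠ 0) (hζ3 : ζ ^ 3 = 1) (hζ1 : ζ ≠ 1) {x y : F}
    (h₀ : W.Nonsingular x y) (h₁ : W.Nonsingular (ζ * x) y) (h₂ : W.Nonsingular (ζ ^ 2 * x) y) :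
    Affine.Point.some (ζ * x) y h₁ + Affine.Point.some (ζ ^ 2 * x) y h₂ +
      Affine.Point.some x y h₀ = 0 := by
  have hζ : ζ ^ 2 + ζ + 1 = 0 := by
    have hprod : (ζ - 1) * (ζ ^ 2 + ζ + 1) = 0 := by linear_combination hζ3
    rcases mul_eq_zero.mp hprod with h | h
    · exact absurd (sub_eq_zero.mp h) hζ1
    · exact h
  by_cases hx : x = 0
  · subst hx
    have hy0 : (2 : F) * y ≠ 0 := by
      refine mul_ne_zero h2 fun hy ↦ ?_
      subst hy
      -- `(0, 0)` is singular on `y² = x³ + a₆`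
      rw [Affine.nonsingular_iff'] at h₀
      simp [ha₁, ha₂, ha₃, ha₄] at h₀
    have e₁ : Affine.Point.some (ζ * 0) y h₁ = Affine.Point.some 0 y h₀ := by congr 1; simp
    have e₂ : Affine.Point.some (ζ ^ 2 * 0) y h₂ = Affine.Point.some 0 y h₀ := by congr 1; simp
    rw [e₁, e₂, some_zero_add_self ha₁ ha₂ ha₃ ha₄ hy0 h₀, neg_add_cancel]
  · have hζ0 : ζ ≠ 0 := by
      intro e; subst e; simp at hζ
    have hx12 : ζ * x ≠ ζ ^ 2 * x := by
      intro e
      have : ζ * (ζ - 1) * x = 0 := by linear_combination -e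
      rcases mul_eq_zero.mp this with h | h
      · rcases mul_eq_zero.mp h with h' | h'
        · exact hζ0 h'
        · exact hζ1 (sub_eq_zero.mp h')
      · exact hx h
    rw [some_add_some_of_Y_eq ha₁ ha₂ ha₃ h₁ h₂ h₀ hx12 (by linear_combination x * hζ),
      neg_add_cancel]

end HorizontalLine

/-! ## §3 The relation `[ζ]² + [ζ] + 1 = 0` on `E(K̄)` for the complex multiplication `[ζ]` of
`y² = x³ + B` over `K ∋ ζ` (the endo-isogeny of `IsogenyRationalCMProofs`) -/

section CM

variable {K : Type u} [Field K]

/-- **`[ζ]² + [ζ] + 1 = 0` on `E(K̄)`** for `E : y² = x³ + B` over a field `K` of characteristic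
`0` containing a primitive cube root of unity `ζ`, and ANY endomorphism `φ` of the geometric points
acting on affine points by `(x, y) ↦ (ζ²x, ζ³y) = (ζ²x, y)` (e.g. the endo-isogeny of
`exists_isogeny_hasLocalPointsMaps_apply_eq`): `φ (φ P) + φ P + P = O` — at an affine point the three
terms are `(ζx, y)`, `(ζ²x, y)`, `(x, y)` (`ζ⁴ = ζ`), which sum to `O`
(`some_add_some_add_some_eq_zero`). This is the relation making `E(K̄)` — and below `H¹(K, E)` and
`Ш(E/K)` — a `ℤ[ζ]`-module. Silverman, *AEC*, III.10.1 (`Aut E ≅ μ₆` for `j = 0`).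
[cite: SilvermanAEC2009, Thm. III.10.1 and Cor. III.10.2] -/
theorem apply_apply_add_apply_add_self_eq_zero [CharZero K] {B ζ : K} (hζ : IsPrimitiveRoot ζ 3)
    (φ : (⟨0, 0, 0, 0, B⟩ : WeierstrassCurve K).geomPoints →+
      (⟨0, 0, 0, 0, B⟩ : WeierstrassCurve K).geomPoints)
    (hφ : ∀ (x y : AlgebraicClosure K)
      (h : ((⟨0, 0, 0, 0, B⟩ : WeierstrassCurve K).baseChange
        (AlgebraicClosure K)).toAffine.Nonsingular x y),
      ∃ h', φ (Affine.Point.some x y h) =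
        Affine.Point.some (algebraMap K (AlgebraicClosure K) ζ ^ 2 * x)
          (algebraMap K (AlgebraicClosure K) ζ ^ 3 * y) h')
    (P : (⟨0, 0, 0, 0, B⟩ : WeierstrassCurve K).geomPoints) : φ (φ P) + φ P + P = 0 := by
  set ζ' : AlgebraicClosure K := algebraMap K (AlgebraicClosure K) ζ with hζ'
  have hζ'3 : ζ' ^ 3 = 1 := by rw [hζ', ← map_pow, hζ.pow_eq_one, map_one]
  have hζ'1 : ζ' ≠ 1 := by
    rw [hζ', ← (algebraMap K (AlgebraicClosure K)).map_one, Ne,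
      (algebraMap K (AlgebraicClosure K)).injective.eq_iff]
    exact hζ.ne_one (by norm_num)
  have h2 : (2 : AlgebraicClosure K) ≠ 0 := by
    rw [← map_ofNat (algebraMap K (AlgebraicClosure K)) 2]
    exact (map_ne_zero _).mpr two_ne_zero
  -- the `a`-invariants of the base change
  set V := ((⟨0, 0, 0, 0, B⟩ : WeierstrassCurve K).baseChange (AlgebraicClosure K)).toAffine with hV
  have ha₁ : V.a₁ = 0 := by simp [hV, baseChange]
  have ha₂ : V.a₂ = 0 := by simp [hV, baseChange]
  have ha₃ : V.a₃ = 0 := by simp [hV, baseChange]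
  have ha₄ : V.a₄ = 0 := by simp [hV, baseChange]
  -- normalised action on affine points: `(x, y) ↦ (ζ'² x, y)`
  have hφ' : ∀ (x y : AlgebraicClosure K)
      (h : ((⟨0, 0, 0, 0, B⟩ : WeierstrassCurve K).baseChange
        (AlgebraicClosure K)).toAffine.Nonsingular x y),
      ∃ h', φ (Affine.Point.some x y h) = Affine.Point.some (ζ' ^ 2 * x) y h' := by
    intro x y h
    obtain ⟨h', e⟩ := hφ x y h
    have ey : ζ' ^ 3 * y = y := by rw [hζ'3, one_mul]
    refine ⟨by simpa [ey] using h', ?_⟩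
    rw [e]
    congr 1
  change ((⟨0, 0, 0, 0, B⟩ : WeierstrassCurve K).baseChange (AlgebraicClosure K)).toAffine.Point at P
  rcases P with _ | ⟨x, y, h⟩
  · have h0 : φ 0 = 0 := map_zero φ
    change φ (φ 0) + φ 0 + 0 = 0
    rw [h0, h0, add_zero, add_zero]
  · obtain ⟨h₁, e₁⟩ := hφ' x y h
    obtain ⟨h₂, e₂⟩ := hφ' (ζ' ^ 2 * x) y h₁
    have ex : ζ' ^ 2 * (ζ' ^ 2 * x) = ζ' * x := by
      linear_combination ζ' * x * hζ'3
    have h₂' : ((⟨0, 0, 0, 0, B⟩ : WeierstrassCurve K).baseChange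
        (AlgebraicClosure K)).toAffine.Nonsingular (ζ' * x) y := by simpa [ex] using h₂
    have e₃ : (Affine.Point.some (ζ' ^ 2 * (ζ' ^ 2 * x)) y h₂ :
        ((⟨0, 0, 0, 0, B⟩ : WeierstrassCurve K).geomPoints)) = Affine.Point.some (ζ' * x) y h₂' := by
      congr 1
    have key := some_add_some_add_some_eq_zero ha₁ ha₂ ha₃ ha₄ h2 hζ'3 hζ'1 h h₂' h₁
    rw [e₁, e₂, e₃]
    exact key

end CM

/-! ## §4 (WRAP-𝒪): the `ℤ[ζ]`-module structure on the tree's `Ш(E/K)` and on `Ш(E/K)[p^∞]` -/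

section Wrap

/-- Restricting an endomorphism of an abelian group to its `p`-primary component (any
homomorphism preserves `p`-power torsion). [folklore] -/
theorem exists_restrict_primaryComponent {G : Type*} [AddCommGroup G] (w : G →+ G) (p : ℕ)
    [Fact p.Prime] :
    ∃ w' : AddCommGroup.primaryComponent G p →+ AddCommGroup.primaryComponent G p,
      ∀ c, ((w' c : AddCommGroup.primaryComponent G p) : G) = w c := by
  have hmem : ∀ c : AddCommGroup.primaryComponent G p,
      w c ∈ AddCommGroup.primaryComponent G p := by
    intro c
    obtain ⟨k, hk⟩ := AddCommGroup.mem_primaryComponent.mp c.2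
    exact AddCommGroup.mem_primaryComponent.mpr ⟨k, by rw [← map_nsmul, hk, map_zero]⟩
  exact ⟨(w.comp (AddCommGroup.primaryComponent G p).subtype).codRestrict _ hmem, fun _ ↦ rfl⟩

/-- An endomorphism relation `w ∘ w + w + 1 = 0` restricts to the `p`-primary component.
[folklore] -/
theorem restrict_relation {G : Type*} [AddCommGroup G] {w : G →+ G} {p : ℕ} [Fact p.Prime]
    {w' : AddCommGroup.primaryComponent G p →+ AddCommGroup.primaryComponent G p}
    (hw' : ∀ c, ((w' c : AddCommGroup.primaryComponent G p) : G) = w c)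
    (hw : ∀ c : G, w (w c) + w c + c = 0) (c : AddCommGroup.primaryComponent G p) :
    w' (w' c) + w' c + c = 0 := by
  apply Subtype.ext
  simp only [AddSubgroup.coe_add, hw', ZeroMemClass.coe_zero]
  exact hw c

/-- Every element of the `2`-primary component is killed by a power of `2` (the hypothesis shape
of `SylvesterTwoUnramifiedDescent.three_zsmul_bijective_of_two_primary`). [folklore] -/
theorem exists_two_zpow_smul_eq_zero {G : Type*} [AddCommGroup G]
    (x : AddCommGroup.primaryComponent G 2) : ∃ n : ℕ, (2 : ℤ) ^ n • x = 0 := by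
  obtain ⟨n, hn⟩ := AddCommGroup.mem_primaryComponent.mp x.2
  refine ⟨n, Subtype.ext ?_⟩
  have e : (2 : ℤ) ^ n • x = (2 ^ n : ℕ) • x := by
    rw [← natCast_zsmul]
    push_cast
    rfl
  rw [e, AddSubmonoidClass.coe_nsmul, hn, ZeroMemClass.coe_zero]

variable {K : Type u} [Field K] [NumberField K]

/-- **(WRAP-𝒪) on `Ш(E/K)`.** For `E : y² = x³ + B` over a number field `K` containing a primitive
cube root of unity `ζ` (e.g. `K ⊇ ℚ(√−3)`; `B ≠ 0` for an elliptic curve, not needed here), the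
complex multiplication `[ζ] : (x, y) ↦ (ζ²x, ζ³y)` is an endo-isogeny over `K`
(`IsogenyRationalCMProofs.exists_isogeny_apply_eq_of_pow_four_mul_eq_of_pow_six_mul_eq`), it satisfies
`[ζ]² + [ζ] + 1 = 0` on `E(K̄)` (`apply_apply_add_apply_add_self_eq_zero`), and the induced
endomorphism `w := Ш([ζ])` of the TREE's Tate–Shafarevich group
`Ш(E/K) = ker (H¹(K, E) → ∏_v H¹(K_v, E))` (`Literature.NumberTheory.EllipticCurves.shaMap`, through the
local points maps `Isogeny.hasLocalPointsMaps_toAddMonoidHom`) satisfies `w (w c) + w c + c = 0`: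
`Ш(E/K)` is a `ℤ[ζ]`-module. This is the «`w`» half of the data `(M, w, σ)` of LEMMA D
(`SylvesterTwoUnramifiedDescent`, Part I of the cell's ROAD (k) series); the «`σ`» half (complex
conjugation on `H¹(K, E)`) is NOT constructed here. Milne, *ADT*, I.§6–7; Silverman, *AEC*,
III.10.1. [cite: MilneADT2006, Ch. I §6 p. 75 and Lemma 7.1 (proof), p. 96]
[cite: SilvermanAEC2009, Thm. III.10.1 and Cor. III.10.2] -/
theorem exists_cm_shaMap_relation {B ζ : K} (hζ : IsPrimitiveRoot ζ 3) :
    ∃ φ : Isogeny (⟨0, 0, 0, 0, B⟩ : WeierstrassCurve K) ⟨0, 0, 0, 0, B⟩,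
      (∀ (x y : AlgebraicClosure K)
        (h : ((⟨0, 0, 0, 0, B⟩ : WeierstrassCurve K).baseChange
          (AlgebraicClosure K)).toAffine.Nonsingular x y),
        ∃ h', φ (Affine.Point.some x y h) =
          Affine.Point.some (algebraMap K (AlgebraicClosure K) ζ ^ 2 * x)
            (algebraMap K (AlgebraicClosure K) ζ ^ 3 * y) h') ∧
      (∀ P, φ (φ P) + φ P + P = 0) ∧
      ∀ c : (⟨0, 0, 0, 0, B⟩ : WeierstrassCurve K).sha,
        shaMap φ.toAddMonoidHom φ.equivariant φ.hasLocalPointsMaps_toAddMonoidHom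
            (shaMap φ.toAddMonoidHom φ.equivariant φ.hasLocalPointsMaps_toAddMonoidHom c) +
          shaMap φ.toAddMonoidHom φ.equivariant φ.hasLocalPointsMaps_toAddMonoidHom c + c = 0 := by
  have hζ0 : ζ ≠ 0 := hζ.ne_zero (by norm_num)
  have h6 : ζ ^ 6 * B = B := by
    rw [show ζ ^ 6 = (ζ ^ 3) ^ 2 by ring, hζ.pow_eq_one]
    ring
  obtain ⟨φ, hφ⟩ :=
    exists_isogeny_apply_eq_of_pow_four_mul_eq_of_pow_six_mul_eq 0 B hζ0 (mul_zero _) h6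
  have hrel : ∀ P, φ (φ P) + φ P + P = 0 :=
    apply_apply_add_apply_add_self_eq_zero hζ φ.toAddMonoidHom hφ
  exact ⟨φ, hφ, hrel, fun c ↦ shaMap_shaMap_add_shaMap_add_self_eq_zero φ.toAddMonoidHom
    φ.equivariant φ.hasLocalPointsMaps_toAddMonoidHom hrel c⟩

/-- **(WRAP-𝒪) on `Ш(E/K)[2^∞]` — the `(M, w)` input of LEMMA D.** Same setting: on
`M := Ш(E/K)[2^∞]` (the `2`-primary component of the tree's `WeierstrassCurve.sha`) the complex
multiplication induces `w : M → M` (the restriction of `Ш([ζ])`) with `w (w x) + w x + x = 0`, and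
`3` acts bijectively on `M` (`SylvesterTwoUnramifiedDescent.three_zsmul_bijective_of_two_primary`) —
exactly the hypotheses `(w, hw, h3)` of `SylvesterTwoUnramifiedDescent.descent_bijective` /
`card_eq_card_invariants_sq`, now available for the GENUINE `Ш(E/ℚ(ω))[2^∞]` of a `j = 0` curve;
the remaining hypotheses there (`σ`, `hσ`, `hσw`: complex conjugation, semilinear) are the open
(WRAP-σ) half. Nothing about the order of `Ш` is claimed. [cite: MilneADT2006, Ch. I §6 p. 75]
[cite: SilvermanAEC2009, Thm. III.10.1 and Cor. III.10.2] -/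
theorem exists_cm_action_sha_two_primary {B ζ : K} (hζ : IsPrimitiveRoot ζ 3) :
    ∃ (φ : Isogeny (⟨0, 0, 0, 0, B⟩ : WeierstrassCurve K) ⟨0, 0, 0, 0, B⟩)
      (w : AddCommGroup.primaryComponent (⟨0, 0, 0, 0, B⟩ : WeierstrassCurve K).sha 2 →+
        AddCommGroup.primaryComponent (⟨0, 0, 0, 0, B⟩ : WeierstrassCurve K).sha 2),
      (∀ (x y : AlgebraicClosure K)
        (h : ((⟨0, 0, 0, 0, B⟩ : WeierstrassCurve K).baseChange
          (AlgebraicClosure K)).toAffine.Nonsingular x y),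
        ∃ h', φ (Affine.Point.some x y h) =
          Affine.Point.some (algebraMap K (AlgebraicClosure K) ζ ^ 2 * x)
            (algebraMap K (AlgebraicClosure K) ζ ^ 3 * y) h') ∧
      (∀ c, ((w c : AddCommGroup.primaryComponent (⟨0, 0, 0, 0, B⟩ : WeierstrassCurve K).sha 2) :
          (⟨0, 0, 0, 0, B⟩ : WeierstrassCurve K).sha) =
        shaMap φ.toAddMonoidHom φ.equivariant φ.hasLocalPointsMaps_toAddMonoidHom c) ∧
      (∀ x, w (w x) + w x + x = 0) ∧
      Function.Bijective fun x : AddCommGroup.primaryComponent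
        (⟨0, 0, 0, 0, B⟩ : WeierstrassCurve K).sha 2 => (3 : ℤ) • x := by
  obtain ⟨φ, hφ, -, hsha⟩ := exists_cm_shaMap_relation (B := B) hζ
  obtain ⟨w, hw⟩ := exists_restrict_primaryComponent
    (shaMap φ.toAddMonoidHom φ.equivariant φ.hasLocalPointsMaps_toAddMonoidHom) 2
  exact ⟨φ, w, hφ, hw, restrict_relation hw hsha,
    SylvesterTwoUnramifiedDescent.three_zsmul_bijective_of_two_primary exists_two_zpow_smul_eq_zero⟩

end Wrap

end Summit.BirchSwinnertonDyer.BirchSwinnertonDyer.Theorems.SylvesterTwoShaOmegaAction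

end
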